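import Summits.QuantumFields.YangMills.Theorems.UnitScaleTiltProp7OneFormConjugateResolventPhaseClass
import HarnessLib

/-!
# Route `UnitScaleTilt`, crux K1 «MinimiserStabilityRegPr» (stmt-QuantumFields-19200), EX rows `hCk` ∕ `h137kΔ` (J-slot) — **K-STOREY BRICK (K2b-δ₃)-E (px12 g17; px10 g13 10:31:46Z «YES PLEASE»):
# THE `δ₃` CLASS LETTER AT A KERNEL-ROW SLOT `Δx = Δ^η + S`** — the J-slot of record `DeltaEtaSlot + TJSlotP` (the slot of `hCk`, `h137kΔ`, `norm_G`, `norm_H₁`) is `Δ^η` plus an operator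
# `S = T_Jᴾ`; a BOUNDED form row `|⟪u, Sv⟫| ≤ τ‖u‖‖v‖` (✓`hTJtau_of_hTJsup`) is NOT enough for the Agmon conjugation letters (the weights `e^{±φ}` are unbounded) — what IS enough is a displayed
# POINTWISE KERNEL ROW of `S` decaying in the block distance (`hkS`, the h133∕h349 text shape with a free `C_S`): then A2a ✓`abs_re_inner_conj_kernel_sub_le` gives the diagonal slot letter
# `hslot` (θ_V) and FILE B1 ✓`norm_inner_conj_kernel_sub_le₂` the bilinear one `hslot₂` (θ₂), both `∝ C_S·θc → 0` with the slope, and (K2b-δ₃)-C ✓`conj_resolvent_oneForm_of_letters` yields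
# px10 g13's `hres` at the slot `Δx` with `θ_r ≥ θ_V(r) + θ_S(r)`.

Cell `ym3-torus` (HUMAN RULING D-0037: SU(2) YM₃ on T³ is ladder rung R3 — NOT d = 4, NOT infinite volume, NOT a mass gap, NOT Clay).  Width seat `ym3-torus-px12` gen 17.  THEOREMS ONLY
(0 `def`, 0 `sorry`, default heartbeats); `--supports stmt-QuantumFields-19200 --as helper`, count-neutral.  HONEST LABEL: instantiation over A2a∕A2e∕B1∕B2∕C; CONDITIONAL on `PosOnto` at the
slot, (γ)∕(C_V) at the slot (✓p767766 `coercive_laplaceA_add_of_curvedTarget_of_lift` gives (γ) with floor `γ − τ`), `hk` (h349), `hQ`, AND the kernel row `hkS` of the slot operator (for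
`S = T_Jᴾ`: NOT in the tree — a sequel «T_J kernel row ⟸ h133 kernel + (q) row», the pointwise twin of ✓`hTJ_of_hHcol_h157`); nothing of (3.132), `hCk`, `h137kΔ`, EX or 19200 is proved here.

WHAT IS PROVED (ns `Summit.QuantumFields.YangMills.Theorems.Prop7OneFormConjugateResolventKernelSlot`; member `F`, `h : n ≤ K`, weights `c₀ cB`, coupling `a`, slot `Δx` with `hΔx : Δx U₀ v = Δ^η v + S U₀ v`).
* ★ `hslot_of_kernelRow` (A2c's diagonal slot letter `θ_S = √2·C_S·θc·(d(L^d)^{K−n}(2(1+1∕(μ′−ν)))³)`), ★ `hslot₂_of_kernelRow` (B2's bilinear slot letter, same `θ_S`).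
* ★★ `hVconj_phaseClass_of_letters_slot` (A4's `hVconj` text at the slot, `θ_V(r) + θ_S(r)`), ★★ `hVconj₂_phaseClass_of_letters_slot` (B2's text at the slot, same number).
* ★★★ `conj_resolvent_oneForm_phaseClass_slot` — px10's `hres` VERBATIM at the slot `Δx`: `δ₃ = δ₃(γ, C_V, r, θ_r, ε)` as in (K2b-δ₃)-D with `hθr : θ_V(r) + θ_S(r) ≤ θ_r`.
HYP-SAT (★★OWNER RULING №42): `hΔx` is `rfl`-class for `Δx := DeltaEtaSlot + TJSlotP` (`Pi.add_apply`); `hkS` is a DISPLAYED letter (h133-class pointwise decay of `T_Jᴾ`; to be discharged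
by the sequel); the rest as (K2b-δ₃)-D; nothing eventual; no hypothesis restates the conclusion.

References: T. Bałaban, CMP **99** (1985) 389–434 [Balaban1985BackgroundPropagators] ((3.26) p.395, Thm 3.1 (3.46) p.398, (3.49) p.399, (3.128)–(3.133) pp.421–422); CMP **102** (1985)
277–309 [Balaban1985Variational] ((134)–(136) p.298); S. Agmon, *Lectures on exponential decay* (Princeton 1982) Ch. 1 [Agmon1982].
-/

set_option autoImplicit false

noncomputable section

open scoped BigOperators Matrix.Norms.L2Operator InnerProductSpace ComplexConjugate

namespace Summit.QuantumFields.YangMills.Theorems.Prop7OneFormConjugateResolventKernelSlot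

open Literature.MathematicalPhysics.QuantumFieldTheory.Balaban1983to89
open Literature.MathematicalPhysics.QuantumFieldTheory.Balaban1983to89.T3ContinuumYM3Torus
open T3SectALandauChart (eta eta_pos bgUnits formComp)
open T3PrintedRegularMinimiser (RegPr)
open T3PrintedRegularOrbits (sites_eq)
open T3LevelShift (bondShift)
open B11Eq103H1Complex (SiteL2K BondL2K)
open B5Eq118OneStroke (iterBlockOf)
open B3Taylor310LocalRemainder (tdist_comm)
open Summit.QuantumFields.YangMills.Theorems.Prop7SectET3Transport (periodsT3)
open Summit.QuantumFields.YangMills.Theorems.Prop7SectET3HilbertLetters (W₂ toL2 toL2S DL2 DstarL2)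
open Summit.QuantumFields.YangMills.Theorems.Prop7SectET3WilsonHessian (DeltaEta DeltaEtaSlot)
open Summit.QuantumFields.YangMills.Theorems.Prop7SectET3GaugeProjector (RS)
open Summit.QuantumFields.YangMills.Theorems.Prop7SectET3CurvedPropagators (laplaceA Qk GT PosOnto)
open Summit.QuantumFields.YangMills.Theorems.Prop7BlockDistanceWeights (tdist_src_tgt_le_one)
open Summit.QuantumFields.YangMills.Theorems.Prop7TwistedSliceGaugeOntoTower (eta_le_one)
open Summit.QuantumFields.YangMills.Theorems.Prop7OneFormAgmonLetters (abs_re_inner_conj_kernel_sub_le)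
open Summit.QuantumFields.YangMills.Theorems.Prop7OneFormAgmonWeights (readSet_ratio_exp_le far_ratio_exp_le hVconj_exp_of_letters)
open Summit.QuantumFields.YangMills.Theorems.Prop7OneFormAgmonPhaseClass (beta_rows iterBlockOf_src_corner)
open Summit.QuantumFields.YangMills.Theorems.Prop7OneFormAgmonBilinear (norm_inner_conj_kernel_sub_le₂)
open Summit.QuantumFields.YangMills.Theorems.Prop7OneFormAgmonBilinearExport (hVconj₂_of_letters)
open Summit.QuantumFields.YangMills.Theorems.Prop7OneFormConjugateResolventOfLetters (conj_resolvent_oneForm_of_letters)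
open Summit.QuantumFields.YangMills.Theorems.Prop7OneFormConjugateResolventPhaseClass (ratio_rows_of_phaseClass)

variable (F : T3Family) {n K : ℕ} (h : n ≤ K) (c₀ cB : ℝ) [Fact (0 < c₀)] [Fact (0 < cB)] {a : ℝ}
  {Δx S : GaugeField (F.P K) 0 (Matrix.specialUnitaryGroup (Fin 2) ℂ) → (BondL2K ℂ 3 (periodsT3 F K) c₀ W₂ →ₗ[ℂ] BondL2K ℂ 3 (periodsT3 F K) c₀ W₂)}

/-! ## §1 The two slot letters from a kernel row of the slot operator -/

omit [Fact (0 < cB)] in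
/-- ★ **THE DIAGONAL SLOT LETTER OF A2c FROM A KERNEL ROW**: if `Δx U₀ = Δ^η(U₀) + S U₀` and `S U₀` has the displayed pointwise kernel row `hkS` (`C_S`, rate `μ′`), then for a weight with far
ratios `|w x∕w x′ − 1| ≤ θc·e^{ν·tdist(Bx,Bx′)}` (`ν < μ′`): `re⟪X, (Δx U₀ − Δ^η)X⟫ − θ_S‖X‖² ≤ re⟪w·X, (Δx U₀ − Δ^η)(w⁻¹·X)⟫`, `θ_S = √2·C_S·θc·(d(L^d)^{K−n}(2(1+1∕(μ′−ν)))³)`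
(A2a ✓`abs_re_inner_conj_kernel_sub_le` at `B := S U₀`). [cite: Balaban1985BackgroundPropagators, Thm 3.1 (3.46) p.398, (3.49) p.399] -/
theorem hslot_of_kernelRow (U₀ : GaugeField (F.P K) 0 (Matrix.specialUnitaryGroup (Fin 2) ℂ))
    (hΔx : ∀ v : BondL2K ℂ 3 (periodsT3 F K) c₀ W₂, Δx U₀ v = DeltaEta F n K c₀ U₀ v + S U₀ v)
    (w : Site (F.P K) 0 → ℝ) {θc ν μ' CS : ℝ} (hθc : 0 ≤ θc) (hCS : 0 ≤ CS) (hνμ : ν < μ')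
    (hwfar : ∀ x x' : Site (F.P K) 0, |w x / w x' - 1| ≤ θc * Real.exp (ν * (Site.tdist (P := F.P K) (iterBlockOf (K - n) x) (iterBlockOf (K - n) x') : ℝ)))
    (hkS : ∀ (b : PBond (F.P K) 0) (Z : Matrix (Fin 2) (Fin 2) ℂ) (bd : PBond (F.P K) 0),
      ‖(toL2 F K c₀).symm (S U₀ (toL2 F K c₀ (Pi.single b Z))) bd‖
        ≤ CS * Real.exp (-(μ' * (Site.tdist (P := F.P K) (iterBlockOf (K - n) b.src) (iterBlockOf (K - n) bd.src) : ℝ))) * ‖Z‖) :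
    ∀ X : PBond (F.P K) 0 → Matrix (Fin 2) (Fin 2) ℂ,
      RCLike.re ⟪toL2 F K c₀ X, (Δx U₀ - (DeltaEta F n K c₀ U₀ : BondL2K ℂ 3 (periodsT3 F K) c₀ W₂ →ₗ[ℂ] BondL2K ℂ 3 (periodsT3 F K) c₀ W₂)) (toL2 F K c₀ X)⟫_ℂ
          - (Real.sqrt 2 * CS * θc * (((F.P K).d : ℝ) * ((((F.P K).L : ℝ) ^ (F.P K).d) ^ (K - n)) * (2 * (1 + 1 / (μ' - ν))) ^ 3)) * ‖toL2 F K c₀ X‖ ^ 2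
        ≤ RCLike.re ⟪toL2 F K c₀ (fun b => w b.src • X b),
            (Δx U₀ - (DeltaEta F n K c₀ U₀ : BondL2K ℂ 3 (periodsT3 F K) c₀ W₂ →ₗ[ℂ] BondL2K ℂ 3 (periodsT3 F K) c₀ W₂)) (toL2 F K c₀ (fun b => (w b.src)⁻¹ • X b))⟫_ℂ := by
  intro X
  have hop : ∀ v, (Δx U₀ - (DeltaEta F n K c₀ U₀ : BondL2K ℂ 3 (periodsT3 F K) c₀ W₂ →ₗ[ℂ] BondL2K ℂ 3 (periodsT3 F K) c₀ W₂)) v = S U₀ v := fun v => by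
    rw [LinearMap.sub_apply, hΔx]; exact add_sub_cancel_left _ _
  rw [hop, hop]
  have h1 := abs_le.mp (abs_re_inner_conj_kernel_sub_le F (S U₀) w hθc hCS hνμ hwfar hkS X)
  linarith [h1.1]

omit [Fact (0 < cB)] in
/-- ★ **THE BILINEAR SLOT LETTER OF FILE B2 FROM A KERNEL ROW**: under the same rows, for all `X′`, `X″`:
`‖⟪w·X′, (Δx U₀ − Δ^η)(w⁻¹·X″)⟫ − ⟪X′, (Δx U₀ − Δ^η)X″⟫‖ ≤ θ_S·‖X′‖·‖X″‖` (B1 ✓`norm_inner_conj_kernel_sub_le₂` at `B := S U₀`). [cite: Balaban1985BackgroundPropagators, Thm 3.1 (3.46) p.398, (3.49) p.399] -/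
theorem hslot₂_of_kernelRow (U₀ : GaugeField (F.P K) 0 (Matrix.specialUnitaryGroup (Fin 2) ℂ))
    (hΔx : ∀ v : BondL2K ℂ 3 (periodsT3 F K) c₀ W₂, Δx U₀ v = DeltaEta F n K c₀ U₀ v + S U₀ v)
    (w : Site (F.P K) 0 → ℝ) {θc ν μ' CS : ℝ} (hθc : 0 ≤ θc) (hCS : 0 ≤ CS) (hνμ : ν < μ')
    (hwfar : ∀ x x' : Site (F.P K) 0, |w x / w x' - 1| ≤ θc * Real.exp (ν * (Site.tdist (P := F.P K) (iterBlockOf (K - n) x) (iterBlockOf (K - n) x') : ℝ)))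
    (hkS : ∀ (b : PBond (F.P K) 0) (Z : Matrix (Fin 2) (Fin 2) ℂ) (bd : PBond (F.P K) 0),
      ‖(toL2 F K c₀).symm (S U₀ (toL2 F K c₀ (Pi.single b Z))) bd‖
        ≤ CS * Real.exp (-(μ' * (Site.tdist (P := F.P K) (iterBlockOf (K - n) b.src) (iterBlockOf (K - n) bd.src) : ℝ))) * ‖Z‖) :
    ∀ X' X'' : PBond (F.P K) 0 → Matrix (Fin 2) (Fin 2) ℂ,
      ‖⟪toL2 F K c₀ (fun b => w b.src • X' b),
          (Δx U₀ - (DeltaEta F n K c₀ U₀ : BondL2K ℂ 3 (periodsT3 F K) c₀ W₂ →ₗ[ℂ] BondL2K ℂ 3 (periodsT3 F K) c₀ W₂)) (toL2 F K c₀ (fun b => (w b.src)⁻¹ • X'' b))⟫_ℂ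
        - ⟪toL2 F K c₀ X', (Δx U₀ - (DeltaEta F n K c₀ U₀ : BondL2K ℂ 3 (periodsT3 F K) c₀ W₂ →ₗ[ℂ] BondL2K ℂ 3 (periodsT3 F K) c₀ W₂)) (toL2 F K c₀ X'')⟫_ℂ‖
        ≤ (Real.sqrt 2 * CS * θc * (((F.P K).d : ℝ) * ((((F.P K).L : ℝ) ^ (F.P K).d) ^ (K - n)) * (2 * (1 + 1 / (μ' - ν))) ^ 3)) * ‖toL2 F K c₀ X'‖ * ‖toL2 F K c₀ X''‖ := by
  intro X' X''
  have hop : ∀ v, (Δx U₀ - (DeltaEta F n K c₀ U₀ : BondL2K ℂ 3 (periodsT3 F K) c₀ W₂ →ₗ[ℂ] BondL2K ℂ 3 (periodsT3 F K) c₀ W₂)) v = S U₀ v := fun v => by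
    rw [LinearMap.sub_apply, hΔx]; exact add_sub_cancel_left _ _
  rw [hop, hop]
  exact norm_inner_conj_kernel_sub_le₂ F (S U₀) w hθc hCS hνμ hwfar hkS X' X''

/-! ## §2 The phase-class letters θ_V, θ₂ at the slot, and the `δ₃` class letter -/

/-- ★★ **A4's `hVconj` AT A KERNEL-ROW SLOT, UNIFORMLY OVER THE PHASE CLASS** (A2e ✓`hVconj_exp_of_letters` at the block corners with §1's diagonal slot letter; A2g's majorisation
`(1 + (e^{rη} − 1))² ≤ e^{2r}`): `θ_V(r) + θ_S(r)`, `θ_S(r) = √2·C_S·(r·d·e^{rd}∕β)·(d(L^d)^{K−n}(2(1+1∕(μ′−(r+β))))³)`, `β = min 1 ((μ′−r)∕2)`.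
[cite: Balaban1985BackgroundPropagators, Thm 3.1 (3.46) p.398, (3.49) p.399; Agmon1982, Ch. 1] -/
theorem hVconj_phaseClass_of_letters_slot {ε₀ : ℝ} (hε₀ : 0 < ε₀) (hε : 10 ^ 10 * (F.L : ℝ) ^ 6 * ε₀ ≤ 1) (hε12 : 10 ^ 12 * (F.L : ℝ) ^ 3 * ε₀ ≤ 1)
    (U₀ : GaugeField (F.P K) 0 (Matrix.specialUnitaryGroup (Fin 2) ℂ)) (hreg : RegPr F n K ε₀ U₀) (ha : 0 ≤ a)
    (hΔx : ∀ v : BondL2K ℂ 3 (periodsT3 F K) c₀ W₂, Δx U₀ v = DeltaEta F n K c₀ U₀ v + S U₀ v)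
    {r μ' Ck CS : ℝ} (hr : 0 ≤ r) (hrμ : r < μ') (hCk : 0 ≤ Ck) (hCS : 0 ≤ CS)
    (hk : ∀ (b : PBond (F.P K) 0) (Z : Matrix (Fin 2) (Fin 2) ℂ) (bd : PBond (F.P K) 0),
      ‖(toL2 F K c₀).symm (DL2 F n K c₀ U₀ (DstarL2 F n K c₀ U₀ (toL2 F K c₀ (Pi.single b Z)) - RS F n K h c₀ cB U₀ (DstarL2 F n K c₀ U₀ (toL2 F K c₀ (Pi.single b Z))))) bd‖
        ≤ Ck * Real.exp (-(μ' * (Site.tdist (P := F.P K) (iterBlockOf (K - n) b.src) (iterBlockOf (K - n) bd.src) : ℝ))) * ‖Z‖)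
    (hkS : ∀ (b : PBond (F.P K) 0) (Z : Matrix (Fin 2) (Fin 2) ℂ) (bd : PBond (F.P K) 0),
      ‖(toL2 F K c₀).symm (S U₀ (toL2 F K c₀ (Pi.single b Z))) bd‖
        ≤ CS * Real.exp (-(μ' * (Site.tdist (P := F.P K) (iterBlockOf (K - n) b.src) (iterBlockOf (K - n) bd.src) : ℝ))) * ‖Z‖)
    {CQ : ℝ} (hQ : ∀ v : BondL2K ℂ 3 (periodsT3 F K) c₀ W₂, ‖Qk F n K h c₀ cB U₀ v‖ ≤ CQ * ‖v‖) :
    ∀ φ : Site (F.P K) 0 → ℝ, (∀ x x' : Site (F.P K) 0, |φ x - φ x'| ≤ r * eta F n K * (Site.tdist x x' : ℝ)) →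
    ∀ X : PBond (F.P K) 0 → Matrix (Fin 2) (Fin 2) ℂ,
      RCLike.re ⟪toL2 F K c₀ X, laplaceA F n K h c₀ cB a Δx U₀ (toL2 F K c₀ X)⟫_ℂ
          - (∑ μ : Fin (F.P K).d, ‖DL2 F n K c₀ U₀ (toL2S F K c₀ (formComp X μ))‖ ^ 2)
          - (a * (2 * Real.sqrt (216 * (Real.exp (r * ((F.P K).d + 1)) - 1) ^ 2 * (cB / (c₀ * ((F.L : ℝ) ^ (K - n)) ^ 3))) * CQ
                  + 216 * (Real.exp (r * ((F.P K).d + 1)) - 1) ^ 2 * (cB / (c₀ * ((F.L : ℝ) ^ (K - n)) ^ 3)))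
              + Real.sqrt 2 * Ck * (r * (F.P K).d * Real.exp (r * (F.P K).d) / min 1 ((μ' - r) / 2))
                  * (((F.P K).d : ℝ) * ((((F.P K).L : ℝ) ^ (F.P K).d) ^ (K - n)) * (2 * (1 + 1 / (μ' - (r + min 1 ((μ' - r) / 2))))) ^ 3)
              + Real.sqrt 2 * CS * (r * (F.P K).d * Real.exp (r * (F.P K).d) / min 1 ((μ' - r) / 2))
                  * (((F.P K).d : ℝ) * ((((F.P K).L : ℝ) ^ (F.P K).d) ^ (K - n)) * (2 * (1 + 1 / (μ' - (r + min 1 ((μ' - r) / 2))))) ^ 3)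
              + 32 * Real.sqrt 2 * ε₀ * (((F.P K).d : ℝ) * (2 * 3) ^ (F.P K).d) * (1 + Real.exp (2 * r))) * ‖toL2 F K c₀ X‖ ^ 2
        ≤ RCLike.re ⟪toL2 F K c₀ (fun b => Real.exp (φ b.src) • X b), laplaceA F n K h c₀ cB a Δx U₀ (toL2 F K c₀ (fun b => (Real.exp (φ b.src))⁻¹ • X b))⟫_ℂ
          - RCLike.re (∑ μ : Fin (F.P K).d, ⟪DL2 F n K c₀ U₀ (toL2S F K c₀ (formComp (fun b => Real.exp (φ b.src) • X b) μ)),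
              DL2 F n K c₀ U₀ (toL2S F K c₀ (formComp (fun b => (Real.exp (φ b.src))⁻¹ • X b) μ))⟫_ℂ) := by
  intro φ hφ' X
  have hη : 0 < eta F n K := eta_pos F n K
  have hη1 : eta F n K ≤ 1 := eta_le_one F (n := n) (K := K)
  obtain ⟨hβ, hβ1, hνμ⟩ := beta_rows (r := r) (μ' := μ') hrμ
  have hφ : ∀ b : PBond (F.P K) 0, |φ b.tgt - φ b.src| ≤ r * eta F n K := fun b => by
    have h1 := hφ' b.tgt b.src
    have h2 : (Site.tdist b.tgt b.src : ℝ) ≤ 1 := by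
      rw [tdist_comm]; exact_mod_cast tdist_src_tgt_le_one b
    calc |φ b.tgt - φ b.src| ≤ r * eta F n K * (Site.tdist b.tgt b.src : ℝ) := h1
      _ ≤ r * eta F n K * 1 := mul_le_mul_of_nonneg_left h2 (mul_nonneg hr hη.le)
      _ = r * eta F n K := mul_one _
  have hθc : 0 ≤ r * (F.P K).d * Real.exp (r * (F.P K).d) / min 1 ((μ' - r) / 2) := by positivity
  -- the diagonal slot letter at `e^{φ}`
  have hslot := hslot_of_kernelRow F c₀ (Δx := Δx) (S := S) U₀ hΔx (fun x => Real.exp (φ x)) hθc hCS hνμ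
    (fun x x' => far_ratio_exp_le F φ hr hφ' hβ hβ1 x x') hkS
  have hmain := hVconj_exp_of_letters F h c₀ cB (a := a) (Δx := Δx) hε₀ hε hε12 U₀ hreg ha φ hr hφ hφ'
    (fun c => Site.fibreSite 0 (K - n) (bondShift (sites_eq F n K h) c).src fun _ => (⟨0, pow_pos (F.P K).L_pos (K - n)⟩ : Fin ((F.P K).L ^ (K - n))))
    (fun c => iterBlockOf_src_corner F h c) hβ hβ1 hνμ hCk hk hQ hslot X
  have hloc : (1 + (1 + (Real.exp (r * eta F n K) - 1)) ^ 2) ≤ 1 + Real.exp (2 * r) := by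
    have e1 : (1 + (Real.exp (r * eta F n K) - 1)) ^ 2 = Real.exp (2 * (r * eta F n K)) := by
      rw [add_sub_cancel, ← Real.exp_nat_mul]; norm_num
    rw [e1]
    have : 2 * (r * eta F n K) ≤ 2 * r := by nlinarith
    linarith [Real.exp_le_exp.mpr this]
  have hX0 : 0 ≤ ‖toL2 F K c₀ X‖ ^ 2 := sq_nonneg _
  have hC0 : 0 ≤ 32 * Real.sqrt 2 * ε₀ * (((F.P K).d : ℝ) * (2 * 3) ^ (F.P K).d) := by positivity
  have hmono := mul_le_mul_of_nonneg_left hloc hC0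
  refine le_trans (sub_le_sub_left (mul_le_mul_of_nonneg_right ?_ hX0) _) hmain
  exact add_le_add_right hmono _

/-- ★★ **B2's BILINEAR LETTER AT A KERNEL-ROW SLOT, UNIFORMLY OVER THE PHASE CLASS** (B2 ✓`hVconj₂_of_letters` at `e^{φ}` + corners with §1's bilinear slot letter): the SAME number
`θ_V(r) + θ_S(r)`. [cite: Balaban1985BackgroundPropagators, Thm 3.1 (3.46) p.398, (3.49) p.399, (3.132) p.422; Agmon1982, Ch. 1] -/
theorem hVconj₂_phaseClass_of_letters_slot {ε₀ : ℝ} (hε₀ : 0 < ε₀) (hε : 10 ^ 10 * (F.L : ℝ) ^ 6 * ε₀ ≤ 1) (hε12 : 10 ^ 12 * (F.L : ℝ) ^ 3 * ε₀ ≤ 1)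
    (U₀ : GaugeField (F.P K) 0 (Matrix.specialUnitaryGroup (Fin 2) ℂ)) (hreg : RegPr F n K ε₀ U₀) (ha : 0 ≤ a)
    (hΔx : ∀ v : BondL2K ℂ 3 (periodsT3 F K) c₀ W₂, Δx U₀ v = DeltaEta F n K c₀ U₀ v + S U₀ v)
    {r μ' Ck CS : ℝ} (hr : 0 ≤ r) (hrμ : r < μ') (hCk : 0 ≤ Ck) (hCS : 0 ≤ CS)
    (hk : ∀ (b : PBond (F.P K) 0) (Z : Matrix (Fin 2) (Fin 2) ℂ) (bd : PBond (F.P K) 0),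
      ‖(toL2 F K c₀).symm (DL2 F n K c₀ U₀ (DstarL2 F n K c₀ U₀ (toL2 F K c₀ (Pi.single b Z)) - RS F n K h c₀ cB U₀ (DstarL2 F n K c₀ U₀ (toL2 F K c₀ (Pi.single b Z))))) bd‖
        ≤ Ck * Real.exp (-(μ' * (Site.tdist (P := F.P K) (iterBlockOf (K - n) b.src) (iterBlockOf (K - n) bd.src) : ℝ))) * ‖Z‖)
    (hkS : ∀ (b : PBond (F.P K) 0) (Z : Matrix (Fin 2) (Fin 2) ℂ) (bd : PBond (F.P K) 0),
      ‖(toL2 F K c₀).symm (S U₀ (toL2 F K c₀ (Pi.single b Z))) bd‖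
        ≤ CS * Real.exp (-(μ' * (Site.tdist (P := F.P K) (iterBlockOf (K - n) b.src) (iterBlockOf (K - n) bd.src) : ℝ))) * ‖Z‖)
    {CQ : ℝ} (hQ : ∀ v : BondL2K ℂ 3 (periodsT3 F K) c₀ W₂, ‖Qk F n K h c₀ cB U₀ v‖ ≤ CQ * ‖v‖) :
    ∀ φ : Site (F.P K) 0 → ℝ, (∀ x x' : Site (F.P K) 0, |φ x - φ x'| ≤ r * eta F n K * (Site.tdist x x' : ℝ)) →
    ∀ X' X'' : PBond (F.P K) 0 → Matrix (Fin 2) (Fin 2) ℂ,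
      |RCLike.re ((⟪toL2 F K c₀ (fun b => Real.exp (φ b.src) • X' b), laplaceA F n K h c₀ cB a Δx U₀ (toL2 F K c₀ (fun b => (Real.exp (φ b.src))⁻¹ • X'' b))⟫_ℂ
            - ∑ κ : Fin (F.P K).d, ⟪DL2 F n K c₀ U₀ (toL2S F K c₀ (formComp (fun b => Real.exp (φ b.src) • X' b) κ)),
                DL2 F n K c₀ U₀ (toL2S F K c₀ (formComp (fun b => (Real.exp (φ b.src))⁻¹ • X'' b) κ))⟫_ℂ)
          - (⟪toL2 F K c₀ X', laplaceA F n K h c₀ cB a Δx U₀ (toL2 F K c₀ X'')⟫_ℂ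
            - ∑ κ : Fin (F.P K).d, ⟪DL2 F n K c₀ U₀ (toL2S F K c₀ (formComp X' κ)), DL2 F n K c₀ U₀ (toL2S F K c₀ (formComp X'' κ))⟫_ℂ))|
        ≤ (a * (2 * Real.sqrt (216 * (Real.exp (r * ((F.P K).d + 1)) - 1) ^ 2 * (cB / (c₀ * ((F.L : ℝ) ^ (K - n)) ^ 3))) * CQ
                  + 216 * (Real.exp (r * ((F.P K).d + 1)) - 1) ^ 2 * (cB / (c₀ * ((F.L : ℝ) ^ (K - n)) ^ 3)))
              + Real.sqrt 2 * Ck * (r * (F.P K).d * Real.exp (r * (F.P K).d) / min 1 ((μ' - r) / 2))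
                  * (((F.P K).d : ℝ) * ((((F.P K).L : ℝ) ^ (F.P K).d) ^ (K - n)) * (2 * (1 + 1 / (μ' - (r + min 1 ((μ' - r) / 2))))) ^ 3)
              + Real.sqrt 2 * CS * (r * (F.P K).d * Real.exp (r * (F.P K).d) / min 1 ((μ' - r) / 2))
                  * (((F.P K).d : ℝ) * ((((F.P K).L : ℝ) ^ (F.P K).d) ^ (K - n)) * (2 * (1 + 1 / (μ' - (r + min 1 ((μ' - r) / 2))))) ^ 3)
              + 32 * Real.sqrt 2 * ε₀ * (((F.P K).d : ℝ) * (2 * 3) ^ (F.P K).d) * (1 + Real.exp (2 * r)))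
          * ‖toL2 F K c₀ X'‖ * ‖toL2 F K c₀ X''‖ := by
  intro φ hφ' X' X''
  have hη : 0 < eta F n K := eta_pos F n K
  have hη1 : eta F n K ≤ 1 := eta_le_one F (n := n) (K := K)
  obtain ⟨hβ, hβ1, hνμ⟩ := beta_rows (r := r) (μ' := μ') hrμ
  obtain ⟨hρ, hρ', -⟩ := ratio_rows_of_phaseClass F (n := n) (K := K) φ hr hφ'
  have hθc : 0 ≤ r * (F.P K).d * Real.exp (r * (F.P K).d) / min 1 ((μ' - r) / 2) := by positivity
  have hslot₂ := hslot₂_of_kernelRow F c₀ (Δx := Δx) (S := S) U₀ hΔx (fun x => Real.exp (φ x)) hθc hCS hνμ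
    (fun x x' => far_ratio_exp_le F φ hr hφ' hβ hβ1 x x') hkS
  have hmain := hVconj₂_of_letters F h c₀ cB (a := a) (Δx := Δx) hε₀ hε hε12 U₀ hreg ha (fun x => Real.exp (φ x)) (fun _ => Real.exp_pos _) hρ hρ'
    (fun c => Site.fibreSite 0 (K - n) (bondShift (sites_eq F n K h) c).src fun _ => (⟨0, pow_pos (F.P K).L_pos (K - n)⟩ : Fin ((F.P K).L ^ (K - n))))
    (fun c b hb => readSet_ratio_exp_le F h φ hr hφ' _ (fun c => iterBlockOf_src_corner F h c) c b hb) hθc hCk hνμ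
    (fun x x' => far_ratio_exp_le F φ hr hφ' hβ hβ1 x x') hk hQ hslot₂ X' X''
  have hloc : (1 + (1 + (Real.exp (r * eta F n K) - 1)) ^ 2) ≤ 1 + Real.exp (2 * r) := by
    have e1 : (1 + (Real.exp (r * eta F n K) - 1)) ^ 2 = Real.exp (2 * (r * eta F n K)) := by
      rw [add_sub_cancel, ← Real.exp_nat_mul]; norm_num
    rw [e1]
    have : 2 * (r * eta F n K) ≤ 2 * r := by nlinarith
    linarith [Real.exp_le_exp.mpr this]
  have hX0 : 0 ≤ ‖toL2 F K c₀ X'‖ * ‖toL2 F K c₀ X''‖ := by positivity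
  have hC0 : 0 ≤ 32 * Real.sqrt 2 * ε₀ * (((F.P K).d : ℝ) * (2 * 3) ^ (F.P K).d) := by positivity
  have hmono := mul_le_mul_of_nonneg_left hloc hC0
  refine hmain.trans ?_
  rw [mul_assoc, mul_assoc _ (‖toL2 F K c₀ X'‖)]
  refine mul_le_mul_of_nonneg_right ?_ hX0
  exact add_le_add_right hmono _

/-- ★★★ **THE `δ₃` CLASS LETTER AT A KERNEL-ROW SLOT** (px10 g13's `hres` VERBATIM at the slot `Δx`, e.g. `DeltaEtaSlot + TJSlotP` once `T_Jᴾ`'s kernel row is served): `RegPr` + windows,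
`PosOnto` at `Δx`, `hΔx`, `0 ≤ a`, `0 ≤ r < μ′`, `hk` (h349), `hkS` (the slot's kernel row), `hQ` (`0 ≤ C_Q`), (γ) `hco` and (C_V) `hVlow` AT THE SLOT, ONE real `θ_r` with
`hθr : θ_V(r) + θ_S(r) ≤ θ_r` (displayed), `0 < ε < 1`, `hΘ`.  THEN `∀ φ` (class `r`), `∀ M_f M_fi` (rows at `e^{±φ(b₋)}`), `∀ x`:
`‖M_f(G_T(M_fi x)) − G_T x‖ ≤ δ₃·‖x‖`, `δ₃ = γ^{−1∕2}·(d₁√(1+C_V∕γ)Θ⁻¹ + d₁γ^{−1∕2}√((Θ⁻¹ + c₁Θ⁻²)∕(1−ε)) + (d₁² + θ_r)γ^{−1∕2}Θ⁻¹)`, `d₁ = √3·r·e^{r}`, `Θ = (1−ε)γ − εC_V − d₁²(1+1∕ε) − θ_r`,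
`c₁ = d₁²(1+1∕ε) + C_V + θ_r`. [cite: Balaban1985BackgroundPropagators, (3.26) p.395, Thm 3.1 (3.46) p.398, (3.49) p.399, (3.128)–(3.133) pp.421–422; Agmon1982, Ch. 1] -/
theorem conj_resolvent_oneForm_phaseClass_slot {ε₀ : ℝ} (hε₀ : 0 < ε₀) (hε : 10 ^ 10 * (F.L : ℝ) ^ 6 * ε₀ ≤ 1) (hε12 : 10 ^ 12 * (F.L : ℝ) ^ 3 * ε₀ ≤ 1)
    (U₀ : GaugeField (F.P K) 0 (Matrix.specialUnitaryGroup (Fin 2) ℂ)) (hreg : RegPr F n K ε₀ U₀) (ha : 0 ≤ a)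
    (hp : PosOnto F n K h c₀ cB a Δx U₀)
    (hΔx : ∀ v : BondL2K ℂ 3 (periodsT3 F K) c₀ W₂, Δx U₀ v = DeltaEta F n K c₀ U₀ v + S U₀ v)
    {r μ' Ck CS : ℝ} (hr : 0 ≤ r) (hrμ : r < μ') (hCk : 0 ≤ Ck) (hCS : 0 ≤ CS)
    (hk : ∀ (b : PBond (F.P K) 0) (Z : Matrix (Fin 2) (Fin 2) ℂ) (bd : PBond (F.P K) 0),
      ‖(toL2 F K c₀).symm (DL2 F n K c₀ U₀ (DstarL2 F n K c₀ U₀ (toL2 F K c₀ (Pi.single b Z)) - RS F n K h c₀ cB U₀ (DstarL2 F n K c₀ U₀ (toL2 F K c₀ (Pi.single b Z))))) bd‖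
        ≤ Ck * Real.exp (-(μ' * (Site.tdist (P := F.P K) (iterBlockOf (K - n) b.src) (iterBlockOf (K - n) bd.src) : ℝ))) * ‖Z‖)
    (hkS : ∀ (b : PBond (F.P K) 0) (Z : Matrix (Fin 2) (Fin 2) ℂ) (bd : PBond (F.P K) 0),
      ‖(toL2 F K c₀).symm (S U₀ (toL2 F K c₀ (Pi.single b Z))) bd‖
        ≤ CS * Real.exp (-(μ' * (Site.tdist (P := F.P K) (iterBlockOf (K - n) b.src) (iterBlockOf (K - n) bd.src) : ℝ))) * ‖Z‖)
    {CQ : ℝ} (hCQ : 0 ≤ CQ) (hQ : ∀ v : BondL2K ℂ 3 (periodsT3 F K) c₀ W₂, ‖Qk F n K h c₀ cB U₀ v‖ ≤ CQ * ‖v‖)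
    {γ CV θr ε : ℝ} (hγ : 0 < γ) (hCV : 0 ≤ CV) (hε1p : 0 < ε) (hε1 : ε < 1)
    (hco : ∀ v : BondL2K ℂ 3 (periodsT3 F K) c₀ W₂, γ * ‖v‖ ^ 2 ≤ RCLike.re ⟪v, laplaceA F n K h c₀ cB a Δx U₀ v⟫_ℂ)
    (hVlow : ∀ X : PBond (F.P K) 0 → Matrix (Fin 2) (Fin 2) ℂ,
      -(CV * ‖toL2 F K c₀ X‖ ^ 2) ≤ RCLike.re ⟪toL2 F K c₀ X, laplaceA F n K h c₀ cB a Δx U₀ (toL2 F K c₀ X)⟫_ℂ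
        - ∑ μ : Fin (F.P K).d, ‖DL2 F n K c₀ U₀ (toL2S F K c₀ (formComp X μ))‖ ^ 2)
    (hθr : a * (2 * Real.sqrt (216 * (Real.exp (r * ((F.P K).d + 1)) - 1) ^ 2 * (cB / (c₀ * ((F.L : ℝ) ^ (K - n)) ^ 3))) * CQ
                  + 216 * (Real.exp (r * ((F.P K).d + 1)) - 1) ^ 2 * (cB / (c₀ * ((F.L : ℝ) ^ (K - n)) ^ 3)))
              + Real.sqrt 2 * Ck * (r * (F.P K).d * Real.exp (r * (F.P K).d) / min 1 ((μ' - r) / 2))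
                  * (((F.P K).d : ℝ) * ((((F.P K).L : ℝ) ^ (F.P K).d) ^ (K - n)) * (2 * (1 + 1 / (μ' - (r + min 1 ((μ' - r) / 2))))) ^ 3)
              + Real.sqrt 2 * CS * (r * (F.P K).d * Real.exp (r * (F.P K).d) / min 1 ((μ' - r) / 2))
                  * (((F.P K).d : ℝ) * ((((F.P K).L : ℝ) ^ (F.P K).d) ^ (K - n)) * (2 * (1 + 1 / (μ' - (r + min 1 ((μ' - r) / 2))))) ^ 3)
              + 32 * Real.sqrt 2 * ε₀ * (((F.P K).d : ℝ) * (2 * 3) ^ (F.P K).d) * (1 + Real.exp (2 * r)) ≤ θr)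
    (hΘ : 0 < (1 - ε) * γ - ε * CV - (Real.sqrt 3 * r * Real.exp r) ^ 2 * (1 + 1 / ε) - θr) :
    ∀ φ : Site (F.P K) 0 → ℝ, (∀ x x' : Site (F.P K) 0, |φ x - φ x'| ≤ r * eta F n K * (Site.tdist x x' : ℝ)) →
    ∀ (Mf Mfi : BondL2K ℂ 3 (periodsT3 F K) c₀ W₂ →ₗ[ℂ] BondL2K ℂ 3 (periodsT3 F K) c₀ W₂),
      (∀ X : PBond (F.P K) 0 → Matrix (Fin 2) (Fin 2) ℂ, Mf (toL2 F K c₀ X) = toL2 F K c₀ (fun b => Real.exp (φ b.src) • X b)) →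
      (∀ X : PBond (F.P K) 0 → Matrix (Fin 2) (Fin 2) ℂ, Mfi (toL2 F K c₀ X) = toL2 F K c₀ (fun b => (Real.exp (φ b.src))⁻¹ • X b)) →
    ∀ x : BondL2K ℂ 3 (periodsT3 F K) c₀ W₂,
      ‖Mf (GT F n K h c₀ cB a Δx U₀ (Mfi x)) - GT F n K h c₀ cB a Δx U₀ x‖
        ≤ (Real.sqrt γ)⁻¹ * ((Real.sqrt 3 * r * Real.exp r) * Real.sqrt (1 + CV / γ) * ((1 - ε) * γ - ε * CV - (Real.sqrt 3 * r * Real.exp r) ^ 2 * (1 + 1 / ε) - θr)⁻¹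
            + (Real.sqrt 3 * r * Real.exp r) * (Real.sqrt γ)⁻¹
                * Real.sqrt ((((1 - ε) * γ - ε * CV - (Real.sqrt 3 * r * Real.exp r) ^ 2 * (1 + 1 / ε) - θr)⁻¹
                    + ((Real.sqrt 3 * r * Real.exp r) ^ 2 * (1 + 1 / ε) + CV + θr) * ((1 - ε) * γ - ε * CV - (Real.sqrt 3 * r * Real.exp r) ^ 2 * (1 + 1 / ε) - θr)⁻¹ ^ 2)
                  / (1 - ε))
            + ((Real.sqrt 3 * r * Real.exp r) ^ 2 + θr) * (Real.sqrt γ)⁻¹ * ((1 - ε) * γ - ε * CV - (Real.sqrt 3 * r * Real.exp r) ^ 2 * (1 + 1 / ε) - θr)⁻¹) * ‖x‖ := by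
  intro φ hφ' Mf Mfi hMf hMfi x
  obtain ⟨hρ, hρ', hd₁⟩ := ratio_rows_of_phaseClass F (n := n) (K := K) φ hr hφ'
  have hθV0 : 0 ≤ θr := by
    refine le_trans ?_ hθr
    have : (0 : ℝ) < (F.P K).L := by exact_mod_cast (F.P K).L_pos
    have hc₀ : 0 < c₀ := Fact.out
    have hcB : 0 < cB := Fact.out
    have hL0 : (0 : ℝ) < F.L := by exact_mod_cast lt_trans zero_lt_one F.hL.2
    have hμr : 0 < μ' - r := by linarith
    have hden : 0 < μ' - (r + min 1 ((μ' - r) / 2)) := by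
      have := min_le_right (1 : ℝ) ((μ' - r) / 2); linarith
    positivity
  have hVconj : ∀ X : PBond (F.P K) 0 → Matrix (Fin 2) (Fin 2) ℂ,
      RCLike.re ⟪toL2 F K c₀ X, laplaceA F n K h c₀ cB a Δx U₀ (toL2 F K c₀ X)⟫_ℂ
          - (∑ μ : Fin (F.P K).d, ‖DL2 F n K c₀ U₀ (toL2S F K c₀ (formComp X μ))‖ ^ 2) - θr * ‖toL2 F K c₀ X‖ ^ 2
        ≤ RCLike.re ⟪toL2 F K c₀ (fun b => Real.exp (φ b.src) • X b), laplaceA F n K h c₀ cB a Δx U₀ (toL2 F K c₀ (fun b => (Real.exp (φ b.src))⁻¹ • X b))⟫_ℂ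
          - RCLike.re (∑ μ : Fin (F.P K).d, ⟪DL2 F n K c₀ U₀ (toL2S F K c₀ (formComp (fun b => Real.exp (φ b.src) • X b) μ)),
              DL2 F n K c₀ U₀ (toL2S F K c₀ (formComp (fun b => (Real.exp (φ b.src))⁻¹ • X b) μ))⟫_ℂ) := fun X => by
    have h1 := hVconj_phaseClass_of_letters_slot F h c₀ cB (a := a) (Δx := Δx) (S := S) hε₀ hε hε12 U₀ hreg ha hΔx hr hrμ hCk hCS hk hkS hQ φ hφ' X
    have hX0 : 0 ≤ ‖toL2 F K c₀ X‖ ^ 2 := sq_nonneg _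
    linarith [h1, mul_le_mul_of_nonneg_right hθr hX0]
  have hVconj₂ : ∀ X' X'' : PBond (F.P K) 0 → Matrix (Fin 2) (Fin 2) ℂ,
      |RCLike.re ((⟪toL2 F K c₀ (fun b => Real.exp (φ b.src) • X' b), laplaceA F n K h c₀ cB a Δx U₀ (toL2 F K c₀ (fun b => (Real.exp (φ b.src))⁻¹ • X'' b))⟫_ℂ
            - ∑ κ : Fin (F.P K).d, ⟪DL2 F n K c₀ U₀ (toL2S F K c₀ (formComp (fun b => Real.exp (φ b.src) • X' b) κ)),
                DL2 F n K c₀ U₀ (toL2S F K c₀ (formComp (fun b => (Real.exp (φ b.src))⁻¹ • X'' b) κ))⟫_ℂ)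
          - (⟪toL2 F K c₀ X', laplaceA F n K h c₀ cB a Δx U₀ (toL2 F K c₀ X'')⟫_ℂ
            - ∑ κ : Fin (F.P K).d, ⟪DL2 F n K c₀ U₀ (toL2S F K c₀ (formComp X' κ)), DL2 F n K c₀ U₀ (toL2S F K c₀ (formComp X'' κ))⟫_ℂ))|
        ≤ θr * ‖toL2 F K c₀ X'‖ * ‖toL2 F K c₀ X''‖ := fun X' X'' => by
    have h1 := hVconj₂_phaseClass_of_letters_slot F h c₀ cB (a := a) (Δx := Δx) (S := S) hε₀ hε hε12 U₀ hreg ha hΔx hr hrμ hCk hCS hk hkS hQ φ hφ' X' X''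
    have hX0 : 0 ≤ ‖toL2 F K c₀ X'‖ * ‖toL2 F K c₀ X''‖ := by positivity
    refine h1.trans ?_
    rw [mul_assoc, mul_assoc θr]
    exact mul_le_mul_of_nonneg_right hθr hX0
  exact conj_resolvent_oneForm_of_letters (h := h) (cB := cB) (a := a) (Δx := Δx) U₀ hp (fun x => Real.exp (φ x)) (fun _ => Real.exp_pos _) hρ hρ'
    Mf Mfi hMf hMfi (by positivity) hd₁ hγ hCV hθV0 hθV0 hε1p hε1 hΘ hco hVlow hVconj hVconj₂ x

end Summit.QuantumFields.YangMills.Theorems.Prop7OneFormConjugateResolventKernelSlot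

end
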